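import Literature.MathematicalPhysics.QuantumFieldTheory.Balaban1983to89.B7Prop7Levels

/-!
# `Balaban1983to89.B7Prop7Ins` — T. Bałaban, *Averaging operations for lattice gauge theories*, Commun. Math. Phys. **98** (1985)
17–51 [Balaban1985Averaging]: **PROPOSITION 7** (p. 43) IN THE PRINTED VARIABLES — the bond variables `A′_b`, `A_b` of two finite bond
sets, `Q_k(U′U₀, ηA) = (1/i) log` of the `k`-th covariant average (90)/(91) at the background `U′U₀` — AT A GENERAL REGULAR BACKGROUND `U₀`

statement-level skeleton of published theorems with citation tags; proofs where landed; nothing here is a claim about the Yang–Mills mass gap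

PDF held: `paper:balaban1985-cmp98-averaging` (journal page = PDF page + 16); p. 43 read on the render
`b2b-balaban-ref1/pages/1985-cmp98-averaging/1985-cmp98-averaging-p027-x2.png` (AS AN IMAGE, this unit, 2026-08-21).

CITATION HEADER (lean-in-tree rule).  Cell `lit-balaban`, unit `lit-balaban-r04` (B7 block owner, gen 4) — SKELETON row **`B7.Prop7`**; the
corollary file of `B7Prop7Levels` (p249465) spelling its two clauses on the polydisc of print.

PRINT (p. 43 [PDF 27], verbatim).  «**Proposition 7.** For U₀ satisfying (52) and U′ = e^{iηA′}, |A′| < α₁, α₀, α₁ sufficiently small, the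
function Q_k(U′U₀, ηA) is analytic in complex variables A′, A, and Proposition 4 holds uniformly in A′.»  And Prop. 4 (p. 38) defines
`Q_k(U, ηA) := (1/i) log U̿₁ᵏ` for `U₁ = e^{iηA}`, the `k`-th order covariant average (90)/(91) at the background `U`, identified with the
composite (127).

WHAT THIS FILE PROVES (kernel, no `sorry`, standard axioms; theorems only), under the DATA of `B7Prop7Levels` (module docstring there; `b′`
plays `ηα₁` for `A′`, `b` for `A`):
* §1 **`dbavgCovIter_cplx_eq_expCfg_logCovIter`** — the identification (127) AT THE COMPLEX BACKGROUND: for every `j ≤ k` the covariant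
  double-bar iterate (90)/(91) of `U₁ = e^{B}` at the background `e^{B′}U₀` IS `e^{Q_j(e^{B′}U₀, B)}` bondwise (`B7Eq92Concrete.dbavgCovIter` vs
  `B7Prop4GeneralLevels.logCovIter`), every one-step average met on the way lying in the disc of the logarithm (21) by
  `B7Prop7OneStep.logDomainCplx` at the complex level backgrounds `Ũ′ʲ·Ū₀ʲ`; hence `norm_mlog_dbavgCovIter_cplx_le`:
  `(1/i) log U̿₁ʲ(c)[background U′U₀] = Q_j(U′U₀, ηB)(c)` and `‖·‖ ≤ 2Lʲb`, `1 ≤ j ≤ k` ((131)/(161) for `U′U₀`).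
* §2 ON THE POLYDISC OF PRINT, `(a′, a) ∈ 𝔸^{S′} × 𝔸^{S}` inserted on two finite bond sets (`B7Prop3Flat.insCfg`), `‖a′_b‖ < ρ′`, `‖a_b‖ < ρ`:
  **`prop7_analyticOnNhd_ins`** — `(a′, a) ↦ Q_j(e^{A′}U₀, A)(c)` is (jointly) analytic on the open polydisc, every `j ≤ k` («analytic in
  complex variables A′, A»); **`prop7_prop4_uniform_ins`** — on the polydisc (130) `‖Q_j(U′U₀, ηA)(c) − LʲηQ_j(U′U₀)A(c)‖ ≤ 8C₁′e^{E(ρ′)}(Lʲ‖a‖)²`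
  and (131) `‖Q_j(U′U₀, ηA)(c)‖ ≤ 2Lʲ‖a‖` with `C₁′ = 2097152(d+1)²`, `E(ρ′) = 4480(d+1)²(d+4)α₀ + 240000(d+1)³Lᵏρ′` — constants depending on
  the radius `ρ′` of the `A′`-polydisc only, NOT on `A′` («Proposition 4 holds uniformly in A′»); and **`prop7_mlog_dbavgCovIter_analyticOnNhd_ins`**
  — for `k ≥ 1` the PRINTED object `(a′, a) ↦ (1/i) log U̿₁ᵏ(c)[U₁ = e^{A}, background e^{A′}U₀]` is analytic on the polydisc (it coincides there
  with the composite, §1).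
HONEST DIVERGENCES (located): as in `B7Prop7Levels` (strict `<` ↦ `≤` in the bounds; explicit `d`-dependent thresholds `ρ′`, `ρ` displayed as
the five smallness inequalities of the DATA, as admissible witnesses of print's «α₀, α₁ sufficiently small»; `c₃/4`, `C₁′ = 16C₁`); the unit `1/i`
and `η` absorbed (lineage conventions); global objects on `ℤᵈ`.
REUSED BY NAME: `B7Prop7Levels.prop7_prop4_uniform / prop7_analyticAt / level_background_data / level_pert_data / level_nu_le`,
`B7Prop7OneStep.logDomainCplx / logCovIter_succ_mul_background`, `B7Eq92Concrete.dbavgCovIter_succ / tildIter_mul`, `B7Prop4Flat.expUnit_mlog /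
isOpen_polydisc`, `B7Prop3Flat.insCfg / analyticAt_insCfg / norm_insCfg_le`.
Unit `lit-balaban-r04` (gen 4), 2026-08-21.

[cite: Balaban1985Averaging, Proposition 7 p.43]
-/

noncomputable section

open scoped BigOperators
open NormedSpace Metric Set Finset

namespace Literature.MathematicalPhysics.QuantumFieldTheory.Balaban1983to89.B7Prop7Ins

open B7Prop1Explicit B7Prop2Explicit B7Prop3Flat B7Eq92Concrete MatrixLog B7Prop3GeneralAnalytic B7Prop3GeneralLinear
  B7Prop4GeneralLevels B7Eq123General B7Prop7OneStep B7Prop7Levels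

-- `Site` alone would resolve to the torus sites of `Setup.lean`; re-export the `ℤ^d` sites of `B7Prop1Explicit`.
export B7Prop1Explicit (Site)

variable {d : ℕ}

variable {𝔸 : Type*} [NormedRing 𝔸] [NormedAlgebra ℂ 𝔸] [CompleteSpace 𝔸] [NormOneClass 𝔸]

/-! ## §1 `U̿₁ʲ[background U′U₀] = e^{Q_j(U′U₀, ηB)}`: the identification (127) at the complex background -/

section Ident

variable (L : ℕ) (hL : 2 ≤ L) {G : Subgroup 𝔸ˣ} (hG : AvgClosed d L G) (k : ℕ)
  (U₀ : Site d → Fin d → 𝔸ˣ) (hU₀ : ∀ x κ, U₀ x κ ∈ G) {α₀ : ℝ} (hα : 0 < α₀)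
  (hα3 : C0 d * α₀ ≤ 1 / 3) (hα8 : 8 * α₀ ≤ c2' d L) (h52 : pdev U₀ < α₀ * (((L : ℝ) ^ k)⁻¹) ^ 2)
  (B' : Site d → Fin d → 𝔸) {b' : ℝ} (hb' : 0 ≤ b') (hB' : ∀ x κ, ‖B' x κ‖ ≤ b')
  (hsmall' : Real.exp (4 * (800 * ((d : ℝ) + 1) ^ 2 * ((d : ℝ) + 4)) * α₀)
    * (1 + 8 * (131072 * ((d : ℝ) + 1) ^ 2) * ((L : ℝ) ^ k * b')) ≤ 2)
  (hc₃' : 2 * ((L : ℝ) ^ k * b') ≤ c3 d L) (hb'1 : 409600 * ((d : ℝ) + 1) ^ 2 * ((L : ℝ) ^ k * b') ≤ 1)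
  (B : Site d → Fin d → 𝔸) {b : ℝ} (hb : 0 ≤ b) (hB : ∀ x κ, ‖B x κ‖ ≤ b)
  (hsmall : Real.exp (4480 * ((d : ℝ) + 1) ^ 2 * ((d : ℝ) + 4) * α₀ + 240000 * ((d : ℝ) + 1) ^ 3 * ((L : ℝ) ^ k * b'))
    * (1 + 8 * (2097152 * ((d : ℝ) + 1) ^ 2) * ((L : ℝ) ^ k * b)) ≤ 2)
  (hc₃ : 2 * ((L : ℝ) ^ k * b) ≤ c3 d L / 4)

include hL hG hU₀ hα hα3 hα8 h52 hb' hB' hsmall' hc₃' hb'1 hb hB hsmall hc₃ in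
/-- **`U̿₁ʲ = e^{Q_j(U′U₀, ηB)}` BONDWISE FOR EVERY `j ≤ k`, AT THE COMPLEX BACKGROUND `U′U₀ = e^{B′}U₀`** — p. 37 (127) «(1/i) log U̿₁ᵏ as a
function of (1/i) log U₁ is a composition of the functions Q(U₀,·), Q(Ū₀,·), …» read at the background `U′U₀` (p. 43: «Ū₀ʲ replaced by
\overline{U′U₀}ʲ = Ũ′ʲŪ₀ʲ»): the iterate (90)/(91) `dbavgCovIter L (e^{B′}U₀) (e^{B}) j` equals `e^{logCovIter L (e^{B′}U₀) B j}`.  Induction on `j`: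
at each level the argument has sup norm `≤ 2Lʲb ≤ c₃/4` ((131) for `U′U₀`, `B7Prop7Levels.prop7_prop4_uniform`), the level background is
`Ũ′ʲ·Ū₀ʲ` with `Ū₀ʲ` regular (`level_background_data`) and `Ũ′ʲ` within `400(d+1)Lʲb′` of `1` ((164), `level_pert_data`), so `‖V̿₁ − 1‖ ≤ 7/10 < 1`
(`B7Prop7OneStep.logDomainCplx`) and `e^{log V̿₁} = V̿₁` (`B7Prop4Flat.expUnit_mlog`). [cite: Balaban1985Averaging, (127) p.37, Proposition 7 p.43, (90)–(91) p.31] -/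
theorem dbavgCovIter_cplx_eq_expCfg_logCovIter :
    ∀ j ≤ k, dbavgCovIter L (expCfg B' * U₀) (expCfg B) j = expCfg (logCovIter L (expCfg B' * U₀) B j) := by
  have hL1 : 1 ≤ L := le_trans (by norm_num) hL
  have hL1r : (1 : ℝ) ≤ L := by exact_mod_cast hL1
  have hα4 : 4 * α₀ ≤ c2' d L := by linarith
  have hbg := level_background_data L hL hG k U₀ hU₀ hα hα3 hα8 h52
  have hpert := level_pert_data L hL hG k U₀ hU₀ hα hα3 hα4 h52 B' hb' hB' hsmall' hc₃' hb'1
  have h131 := fun j hj => (prop7_prop4_uniform L hL hG k U₀ hU₀ hα hα3 hα8 h52 B' hb' hB' hsmall' hc₃' hb'1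
    B hb hB hsmall hc₃ j hj).2
  have hncast : (((2 * (d * L) + L + L : ℕ)) : ℝ) = 2 * ((d : ℝ) + 1) * L := by push_cast; ring
  have hnc3 : (((2 * (d * L) + L + L : ℕ)) : ℝ) * (c3 d L / 4) = 1 / 256 := by
    rw [hncast, c3]
    have hL0 : (0 : ℝ) < L := by linarith
    field_simp
    ring
  intro j
  induction j with
  | zero => intro _; rfl
  | succ j ih =>
    intro hjk
    have hj : j < k := Nat.lt_of_succ_le hjk
    obtain ⟨hV, hloops⟩ := hbg j hj.le
    have hU := hpert j hj.le
    have hnu := level_nu_le L hL k hb' hb'1 hj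
    have ha : 0 ≤ 2 * ((L : ℝ) ^ j * b) := by positivity
    have hA := h131 j hj.le
    have hac : 2 * ((L : ℝ) ^ j * b) ≤ c3 d L / 4 := by
      have := mul_le_mul_of_nonneg_right (pow_le_pow_right₀ hL1r hj.le) hb
      linarith
    have hθ : (((2 * (d * L) + L + L : ℕ)) : ℝ) * (2 * ((L : ℝ) ^ j * b) + 2 * (400 * ((d : ℝ) + 1) * ((L : ℝ) ^ j * b')))
        ≤ 1 / 128 := by
      have h1 : (((2 * (d * L) + L + L : ℕ)) : ℝ) * (2 * ((L : ℝ) ^ j * b)) ≤ 1 / 256 := by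
        rw [← hnc3]; exact mul_le_mul_of_nonneg_left hac (by positivity)
      nlinarith
    funext z κ
    obtain ⟨hreg, hα1⟩ := hloops ((L : ℤ) • z) κ
    have hdom := (logDomainCplx hL1 hV (by positivity) hU (logCovIter L (expCfg B' * U₀) B j) ha hA hθ (by norm_num) le_rfl
      ((L : ℤ) • z) κ hα1 hreg).2.2.2.2
    have hcfg : tildIter L U₀ (expCfg B') j * avgIter L U₀ j = avgIter L (expCfg B' * U₀) j := tildIter_mul L U₀ (expCfg B') j
    rw [hcfg] at hdom
    have hlt : ‖((dbavgCov L (avgIter L (expCfg B' * U₀) j) (expCfg (logCovIter L (expCfg B' * U₀) B j)) ((L : ℤ) • z) κ : 𝔸ˣ) : 𝔸)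
        - 1‖ < 1 := hdom.trans_lt (by norm_num)
    rw [dbavgCovIter_succ, ih hj.le]
    show _ = expUnit (logCovIter L (expCfg B' * U₀) B (j + 1) z κ)
    rw [logCovIter_succ]
    exact (B7Prop4Flat.expUnit_mlog hlt).symm

include hL hG hU₀ hα hα3 hα8 h52 hb' hB' hsmall' hc₃' hb'1 hb hB hsmall hc₃ in
/-- **(131)/(161) FOR `U′U₀`, ON THE PRINTED OBJECT**: for `1 ≤ j ≤ k` and every `Lʲ`-bond, the logarithm (21) of the `j`-fold covariant average
(91) of `U₁ = e^{B}` at the background `U′U₀ = e^{B′}U₀` IS the composite `Q_j(U′U₀, ηB)` (127), and `‖(1/i) log U̿₁ʲ‖ ≤ 2Lʲb` — uniformly in `U′`.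
[cite: Balaban1985Averaging, Proposition 7 p.43, (131) p.38, (161) p.42, (127) p.37] -/
theorem norm_mlog_dbavgCovIter_cplx_le {j : ℕ} (hjk : j + 1 ≤ k) (z : Site d) (κ : Fin d) :
    mlog ((dbavgCovIter L (expCfg B' * U₀) (expCfg B) (j + 1) z κ : 𝔸ˣ) : 𝔸) = logCovIter L (expCfg B' * U₀) B (j + 1) z κ ∧
      ‖mlog ((dbavgCovIter L (expCfg B' * U₀) (expCfg B) (j + 1) z κ : 𝔸ˣ) : 𝔸)‖ ≤ 2 * ((L : ℝ) ^ (j + 1) * b) := by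
  have hval : mlog ((dbavgCovIter L (expCfg B' * U₀) (expCfg B) (j + 1) z κ : 𝔸ˣ) : 𝔸)
      = logCovIter L (expCfg B' * U₀) B (j + 1) z κ := by
    rw [dbavgCovIter_succ, dbavgCovIter_cplx_eq_expCfg_logCovIter L hL hG k U₀ hU₀ hα hα3 hα8 h52 B' hb' hB' hsmall' hc₃' hb'1
      B hb hB hsmall hc₃ j (Nat.le_of_succ_le hjk), logCovIter_succ]
    rfl
  exact ⟨hval, hval ▸ (prop7_prop4_uniform L hL hG k U₀ hU₀ hα hα3 hα8 h52 B' hb' hB' hsmall' hc₃' hb'1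
    B hb hB hsmall hc₃ (j + 1) hjk).2 z κ⟩

end Ident

/-! ## §2 Proposition 7 on the polydisc of print: bond variables `(A′_b)_{b ∈ S′}`, `(A_b)_{b ∈ S}` -/

omit [NormedAlgebra ℂ 𝔸] [CompleteSpace 𝔸] [NormOneClass 𝔸] in
/-- the smallness DATA of `B7Prop7Levels` is monotone in `(b′, b)`: it passes from the polydisc radii `(ρ′, ρ)` to any `b′ ≤ ρ′`, `b ≤ ρ`
(bookkeeping for the polydisc statements). [cite: Balaban1985Averaging, Proposition 7 p.43] -/
theorem smallness7_mono {L k : ℕ} {α₀ b' ρ' b ρ : ℝ} (hb'ρ : b' ≤ ρ') (hb : 0 ≤ b) (hbρ : b ≤ ρ)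
    (hsmall' : Real.exp (4 * (800 * ((d : ℝ) + 1) ^ 2 * ((d : ℝ) + 4)) * α₀)
      * (1 + 8 * (131072 * ((d : ℝ) + 1) ^ 2) * ((L : ℝ) ^ k * ρ')) ≤ 2)
    (hc₃' : 2 * ((L : ℝ) ^ k * ρ') ≤ c3 d L) (hρ'1 : 409600 * ((d : ℝ) + 1) ^ 2 * ((L : ℝ) ^ k * ρ') ≤ 1)
    (hsmall : Real.exp (4480 * ((d : ℝ) + 1) ^ 2 * ((d : ℝ) + 4) * α₀ + 240000 * ((d : ℝ) + 1) ^ 3 * ((L : ℝ) ^ k * ρ'))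
      * (1 + 8 * (2097152 * ((d : ℝ) + 1) ^ 2) * ((L : ℝ) ^ k * ρ)) ≤ 2)
    (hc₃ : 2 * ((L : ℝ) ^ k * ρ) ≤ c3 d L / 4) :
    Real.exp (4 * (800 * ((d : ℝ) + 1) ^ 2 * ((d : ℝ) + 4)) * α₀)
        * (1 + 8 * (131072 * ((d : ℝ) + 1) ^ 2) * ((L : ℝ) ^ k * b')) ≤ 2 ∧
      2 * ((L : ℝ) ^ k * b') ≤ c3 d L ∧ 409600 * ((d : ℝ) + 1) ^ 2 * ((L : ℝ) ^ k * b') ≤ 1 ∧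
      Real.exp (4480 * ((d : ℝ) + 1) ^ 2 * ((d : ℝ) + 4) * α₀ + 240000 * ((d : ℝ) + 1) ^ 3 * ((L : ℝ) ^ k * b'))
          * (1 + 8 * (2097152 * ((d : ℝ) + 1) ^ 2) * ((L : ℝ) ^ k * b)) ≤ 2 ∧
      2 * ((L : ℝ) ^ k * b) ≤ c3 d L / 4 := by
  have hLk : (0 : ℝ) ≤ (L : ℝ) ^ k := by positivity
  have hm' : (L : ℝ) ^ k * b' ≤ (L : ℝ) ^ k * ρ' := mul_le_mul_of_nonneg_left hb'ρ hLk
  have hm : (L : ℝ) ^ k * b ≤ (L : ℝ) ^ k * ρ := mul_le_mul_of_nonneg_left hbρ hLk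
  have hd1 : (0 : ℝ) ≤ ((d : ℝ) + 1) ^ 2 := by positivity
  refine ⟨?_, by linarith, by nlinarith, ?_, by linarith⟩
  · have hexp : 0 ≤ Real.exp (4 * (800 * ((d : ℝ) + 1) ^ 2 * ((d : ℝ) + 4)) * α₀) := (Real.exp_pos _).le
    have hfac : 1 + 8 * (131072 * ((d : ℝ) + 1) ^ 2) * ((L : ℝ) ^ k * b')
        ≤ 1 + 8 * (131072 * ((d : ℝ) + 1) ^ 2) * ((L : ℝ) ^ k * ρ') := by nlinarith
    exact (mul_le_mul_of_nonneg_left hfac hexp).trans hsmall'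
  · have hE : Real.exp (4480 * ((d : ℝ) + 1) ^ 2 * ((d : ℝ) + 4) * α₀ + 240000 * ((d : ℝ) + 1) ^ 3 * ((L : ℝ) ^ k * b'))
        ≤ Real.exp (4480 * ((d : ℝ) + 1) ^ 2 * ((d : ℝ) + 4) * α₀ + 240000 * ((d : ℝ) + 1) ^ 3 * ((L : ℝ) ^ k * ρ')) := by
      apply Real.exp_le_exp.2
      have : 0 ≤ ((d : ℝ) + 1) ^ 3 := by positivity
      nlinarith
    have hfac : 1 + 8 * (2097152 * ((d : ℝ) + 1) ^ 2) * ((L : ℝ) ^ k * b)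
        ≤ 1 + 8 * (2097152 * ((d : ℝ) + 1) ^ 2) * ((L : ℝ) ^ k * ρ) := by nlinarith
    have hfac0 : 0 ≤ 1 + 8 * (2097152 * ((d : ℝ) + 1) ^ 2) * ((L : ℝ) ^ k * b) := by
      have : 0 ≤ (L : ℝ) ^ k * b := mul_nonneg hLk hb
      positivity
    calc Real.exp (4480 * ((d : ℝ) + 1) ^ 2 * ((d : ℝ) + 4) * α₀ + 240000 * ((d : ℝ) + 1) ^ 3 * ((L : ℝ) ^ k * b'))
          * (1 + 8 * (2097152 * ((d : ℝ) + 1) ^ 2) * ((L : ℝ) ^ k * b))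
        ≤ Real.exp (4480 * ((d : ℝ) + 1) ^ 2 * ((d : ℝ) + 4) * α₀ + 240000 * ((d : ℝ) + 1) ^ 3 * ((L : ℝ) ^ k * ρ'))
          * (1 + 8 * (2097152 * ((d : ℝ) + 1) ^ 2) * ((L : ℝ) ^ k * ρ)) :=
          mul_le_mul hE hfac hfac0 (Real.exp_pos _).le
      _ ≤ 2 := hsmall

omit [NormedAlgebra ℂ 𝔸] [CompleteSpace 𝔸] [NormOneClass 𝔸] in
/-- the product polydisc `{(a′, a) : ∀ b, ‖a′_b‖ < ρ′ ∧ ∀ b, ‖a_b‖ < ρ}` is open — bookkeeping. [cite: Balaban1985Averaging, Proposition 7 p.43] -/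
theorem isOpen_polydisc₂ (S' S : Finset (Site d × Fin d)) (ρ' ρ : ℝ) :
    IsOpen {t : (S' → 𝔸) × (S → 𝔸) | (∀ s, ‖t.1 s‖ < ρ') ∧ ∀ s, ‖t.2 s‖ < ρ} :=
  ((B7Prop4Flat.isOpen_polydisc S' ρ').preimage continuous_fst).inter
    ((B7Prop4Flat.isOpen_polydisc S ρ).preimage continuous_snd)

section Polydisc

variable (S' S : Finset (Site d × Fin d)) (L : ℕ) (hL : 2 ≤ L) {G : Subgroup 𝔸ˣ} (hG : AvgClosed d L G) (k : ℕ)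
  (U₀ : Site d → Fin d → 𝔸ˣ) (hU₀ : ∀ x κ, U₀ x κ ∈ G) {α₀ : ℝ} (hα : 0 < α₀)
  (hα3 : C0 d * α₀ ≤ 1 / 3) (hα8 : 8 * α₀ ≤ c2' d L) (h52 : pdev U₀ < α₀ * (((L : ℝ) ^ k)⁻¹) ^ 2)
  {ρ' ρ : ℝ} (hρ' : 0 < ρ') (hρ : 0 < ρ)
  (hsmall' : Real.exp (4 * (800 * ((d : ℝ) + 1) ^ 2 * ((d : ℝ) + 4)) * α₀)
    * (1 + 8 * (131072 * ((d : ℝ) + 1) ^ 2) * ((L : ℝ) ^ k * ρ')) ≤ 2)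
  (hc₃' : 2 * ((L : ℝ) ^ k * ρ') ≤ c3 d L) (hρ'1 : 409600 * ((d : ℝ) + 1) ^ 2 * ((L : ℝ) ^ k * ρ') ≤ 1)
  (hsmall : Real.exp (4480 * ((d : ℝ) + 1) ^ 2 * ((d : ℝ) + 4) * α₀ + 240000 * ((d : ℝ) + 1) ^ 3 * ((L : ℝ) ^ k * ρ'))
    * (1 + 8 * (2097152 * ((d : ℝ) + 1) ^ 2) * ((L : ℝ) ^ k * ρ)) ≤ 2)
  (hc₃ : 2 * ((L : ℝ) ^ k * ρ) ≤ c3 d L / 4)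

include hL hG hU₀ hα hα3 hα8 h52 hρ' hρ hsmall' hc₃' hρ'1 hsmall hc₃ in
/-- **PROPOSITION 7 — «the function Q_k(U′U₀, ηA) is analytic in complex variables A′, A»**, IN THE PRINTED VARIABLES: for every two finite
bond sets `S′`, `S` and every `j ≤ k`, the map `(a′, a) ∈ 𝔸^{S′} × 𝔸^{S} ↦ Q_j(e^{A′}U₀, A)(c)` (`A′ = a′` on `S′`, `A = a` on `S`, zero off them:
`B7Prop3Flat.insCfg`) is analytic on a neighbourhood of every point of the open polydisc `{∀ b, ‖a′_b‖ < ρ′} × {∀ b, ‖a_b‖ < ρ}`, the radii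
being print's `α₁` («|A′| < α₁ … sufficiently small») displayed as the five smallness inequalities of the DATA.  From
`B7Prop7Levels.prop7_analyticAt` (parameter space `E = 𝔸^{S′} × 𝔸^{S}`, the coordinates being analytic). [cite: Balaban1985Averaging, Proposition 7 p.43] -/
theorem prop7_analyticOnNhd_ins :
    ∀ j ≤ k, ∀ (z : Site d) (κ : Fin d),
      AnalyticOnNhd ℂ (fun t : (S' → 𝔸) × (S → 𝔸) => logCovIter L (expCfg (insCfg S' t.1) * U₀) (insCfg S t.2) j z κ)
        {t | (∀ s, ‖t.1 s‖ < ρ') ∧ ∀ s, ‖t.2 s‖ < ρ} := by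
  intro j hj z κ t ht
  have hn' : ‖t.1‖ < ρ' := (pi_norm_lt_iff hρ').2 ht.1
  have hn : ‖t.2‖ < ρ := (pi_norm_lt_iff hρ).2 ht.2
  obtain ⟨hs', hc', h1', hs, hc⟩ := smallness7_mono (d := d) (L := L) (k := k) (α₀ := α₀) hn'.le
    (norm_nonneg t.2) hn.le hsmall' hc₃' hρ'1 hsmall hc₃
  have hB'a : ∀ x κ', AnalyticAt ℂ (fun t' : (S' → 𝔸) × (S → 𝔸) => insCfg S' t'.1 x κ') t := fun x κ' =>
    (analyticAt_insCfg S' x κ' t.1).comp analyticAt_fst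
  have hBa : ∀ x κ', AnalyticAt ℂ (fun t' : (S' → 𝔸) × (S → 𝔸) => insCfg S t'.2 x κ') t := fun x κ' =>
    (analyticAt_insCfg S x κ' t.2).comp analyticAt_snd
  exact prop7_analyticAt L hL hG k U₀ hU₀ hα hα3 hα8 h52 (fun t' : (S' → 𝔸) × (S → 𝔸) => insCfg S' t'.1) hB'a
    (norm_nonneg t.1) (fun x κ' => norm_insCfg_le S' t.1 x κ') hs' hc' h1'
    (fun t' : (S' → 𝔸) × (S → 𝔸) => insCfg S t'.2) hBa (norm_nonneg t.2) (fun x κ' => norm_insCfg_le S t.2 x κ') hs hc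
    j hj z κ

include hL hG hU₀ hα hα3 hα8 h52 hρ' hρ hsmall' hc₃' hρ'1 hsmall hc₃ in
/-- **PROPOSITION 7 — «Proposition 4 holds uniformly in A′»**, IN THE PRINTED VARIABLES: on the polydisc `{∀ b, ‖a′_b‖ < ρ′} × {∀ b, ‖a_b‖ < ρ}`,
for every `j ≤ k` and every `Lʲ`-bond `c`: (130) `‖Q_j(e^{A′}U₀, A)(c) − LʲQ_j(e^{A′}U₀)A(c)‖ ≤ 8C₁′·e^{E(ρ′)}·(Lʲ‖a‖)²` and (131)
`‖Q_j(e^{A′}U₀, A)(c)‖ ≤ 2Lʲ‖a‖`, with `C₁′ = 2097152(d+1)²` and `E(ρ′) = 4480(d+1)²(d+4)α₀ + 240000(d+1)³Lᵏρ′` — the constants depend on `d`,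
`α₀` and the RADIUS `ρ′` of the `A′`-polydisc only, not on `A′`, `j`, `k`.  From `B7Prop7Levels.prop7_prop4_uniform`.
[cite: Balaban1985Averaging, Proposition 7 p.43, Proposition 4 (130)–(131) p.38] -/
theorem prop7_prop4_uniform_ins (t : (S' → 𝔸) × (S → 𝔸)) (ht : (∀ s, ‖t.1 s‖ < ρ') ∧ ∀ s, ‖t.2 s‖ < ρ) :
    ∀ j ≤ k, ∀ (z : Site d) (κ : Fin d),
      ‖logCovIter L (expCfg (insCfg S' t.1) * U₀) (insCfg S t.2) j z κ
          - linCovIter L (expCfg (insCfg S' t.1) * U₀) (insCfg S t.2) j z κ‖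
        ≤ 8 * (2097152 * ((d : ℝ) + 1) ^ 2)
          * Real.exp (4480 * ((d : ℝ) + 1) ^ 2 * ((d : ℝ) + 4) * α₀ + 240000 * ((d : ℝ) + 1) ^ 3 * ((L : ℝ) ^ k * ρ'))
          * ((L : ℝ) ^ j * ‖t.2‖) ^ 2 ∧
      ‖logCovIter L (expCfg (insCfg S' t.1) * U₀) (insCfg S t.2) j z κ‖ ≤ 2 * ((L : ℝ) ^ j * ‖t.2‖) := by
  intro j hj z κ
  have hn' : ‖t.1‖ < ρ' := (pi_norm_lt_iff hρ').2 ht.1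
  have hn : ‖t.2‖ < ρ := (pi_norm_lt_iff hρ).2 ht.2
  obtain ⟨hs', hc', h1', hs, hc⟩ := smallness7_mono (d := d) (L := L) (k := k) (α₀ := α₀) hn'.le
    (norm_nonneg t.2) hn.le hsmall' hc₃' hρ'1 hsmall hc₃
  obtain ⟨h130, h131⟩ := prop7_prop4_uniform L hL hG k U₀ hU₀ hα hα3 hα8 h52 (insCfg S' t.1) (norm_nonneg t.1)
    (fun x κ' => norm_insCfg_le S' t.1 x κ') hs' hc' h1' (insCfg S t.2) (norm_nonneg t.2) (fun x κ' => norm_insCfg_le S t.2 x κ')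
    hs hc j hj
  refine ⟨(h130 z κ).trans ?_, h131 z κ⟩
  have hE : Real.exp (4480 * ((d : ℝ) + 1) ^ 2 * ((d : ℝ) + 4) * α₀ + 240000 * ((d : ℝ) + 1) ^ 3 * ((L : ℝ) ^ k * ‖t.1‖))
      ≤ Real.exp (4480 * ((d : ℝ) + 1) ^ 2 * ((d : ℝ) + 4) * α₀ + 240000 * ((d : ℝ) + 1) ^ 3 * ((L : ℝ) ^ k * ρ')) := by
    apply Real.exp_le_exp.2
    have hLk : (0 : ℝ) ≤ (L : ℝ) ^ k := by positivity
    have hm' : (L : ℝ) ^ k * ‖t.1‖ ≤ (L : ℝ) ^ k * ρ' := mul_le_mul_of_nonneg_left hn'.le hLk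
    have : 0 ≤ ((d : ℝ) + 1) ^ 3 := by positivity
    nlinarith
  have h8 : 0 ≤ 8 * (2097152 * ((d : ℝ) + 1) ^ 2) := by positivity
  exact mul_le_mul_of_nonneg_right (mul_le_mul_of_nonneg_left hE h8) (sq_nonneg _)

include hL hG hU₀ hα hα3 hα8 h52 hρ' hρ hsmall' hc₃' hρ'1 hsmall hc₃ in
/-- **PROPOSITION 7 FOR THE PRINTED OBJECT `Q_k(U′U₀, ηA) := (1/i) log U̿₁ᵏ` (Prop. 4's definition, the `k`-th covariant average (90)/(91) of
`U₁ = e^{A}` at the background `U′U₀ = e^{A′}U₀`)**: for `k ≥ 1` the map `(a′, a) ↦ log U̿₁ᵏ(c)` — `mlog (dbavgCovIter L (e^{insCfg S′ a′}·U₀)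
(e^{insCfg S a}) k c)` — is analytic on a neighbourhood of every point of the polydisc `{∀ b, ‖a′_b‖ < ρ′} × {∀ b, ‖a_b‖ < ρ}`, on which it
coincides with the composite (127) at the background `e^{A′}U₀` (`norm_mlog_dbavgCovIter_cplx_le`).  (The unit `1/i` is immaterial.)
[cite: Balaban1985Averaging, Proposition 7 p.43, Proposition 4 p.38, (127) p.37, (90)–(91) p.31] -/
theorem prop7_mlog_dbavgCovIter_analyticOnNhd_ins (hk : 1 ≤ k) (z : Site d) (κ : Fin d) :
    AnalyticOnNhd ℂ (fun t : (S' → 𝔸) × (S → 𝔸) =>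
        mlog ((dbavgCovIter L (expCfg (insCfg S' t.1) * U₀) (expCfg (insCfg S t.2)) k z κ : 𝔸ˣ) : 𝔸))
      {t | (∀ s, ‖t.1 s‖ < ρ') ∧ ∀ s, ‖t.2 s‖ < ρ} := by
  obtain ⟨j, rfl⟩ : ∃ j, k = j + 1 := ⟨k - 1, (Nat.sub_add_cancel hk).symm⟩
  have hmodel := prop7_analyticOnNhd_ins S' S L hL hG (j + 1) U₀ hU₀ hα hα3 hα8 h52 hρ' hρ hsmall' hc₃' hρ'1 hsmall hc₃
    (j + 1) le_rfl z κ
  refine hmodel.congr (isOpen_polydisc₂ S' S ρ' ρ) fun t ht => ?_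
  have hn' : ‖t.1‖ < ρ' := (pi_norm_lt_iff hρ').2 ht.1
  have hn : ‖t.2‖ < ρ := (pi_norm_lt_iff hρ).2 ht.2
  obtain ⟨hs', hc', h1', hs, hc⟩ := smallness7_mono (d := d) (L := L) (k := j + 1) (α₀ := α₀) hn'.le
    (norm_nonneg t.2) hn.le hsmall' hc₃' hρ'1 hsmall hc₃
  exact ((norm_mlog_dbavgCovIter_cplx_le L hL hG (j + 1) U₀ hU₀ hα hα3 hα8 h52 (insCfg S' t.1) (norm_nonneg t.1)
    (fun x κ' => norm_insCfg_le S' t.1 x κ') hs' hc' h1' (insCfg S t.2) (norm_nonneg t.2)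
    (fun x κ' => norm_insCfg_le S t.2 x κ') hs hc le_rfl z κ).1).symm

end Polydisc

end Literature.MathematicalPhysics.QuantumFieldTheory.Balaban1983to89.B7Prop7Ins

end
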